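import Summits.ResolutionOfSingularities.ResolutionOfSingularities.Theorems.MarkedTransferCampaignW46MohWindowShadeTerminatesFin
import Summits.ResolutionOfSingularities.ResolutionOfSingularities.Theorems.MarkedTransferCampaignW46MohWindowShadeTerminalCentresExit
import HarnessLib

/-!
# [OURS · L1 W4.6] Rung (iii) "Moh window", terminal case under minimal coordinate centres — the FIN CLOSER of the
  OURS-desk #73 repair (proofs; transport of res-L1-s46-pv-6's `length_le_of_minimalCentres` to `n < N` hypotheses)

Cell `res-hironaka`, LADDER-RESOLUTION rung L (D-0089), slot W4.6, rung (iii). DRAFT prepared by res-L1-type-o1 (OURS typer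
o1) for filing `--kind proof --supports stmt-ResolutionOfSingularities-16155 --as helper` (0 defs). Content:
`CampaignW46.MohWindowShadeTerminalCentresExit.length_le_of_minimalCentresFin` = pv-6's `length_le_of_minimalCentres`
(`…MohWindowShadeTerminalCentresExit.lean` l.157–205, p486590, gen 2) with the two centre hypotheses restricted to `n < N`
— the SAME induction, which only ever used them at the index of the step being taken (as res-adj-8's RULING 03:35:00Z
observed; pv-6's total form is the special case `fun n _ => hS n`, not restated — gate dedup); and the closer BY NAME
`campaignW46MohWindowShadeTerminalCentreTerminatesFin_holds : CampaignW46MohWindowShadeTerminalCentreTerminatesFin p K σ`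
for every prime `p`, field `K` of characteristic `p`, finite `σ`. Nothing of H. Hironaka's manuscript
[claim: Hironaka2017, status: under-review] is used or asserted. AI-written; AI review is weaker than expert review.
-/

noncomputable section

set_option linter.dupNamespace false -- mandated namespace of this single-conjunct summit

namespace Summit.ResolutionOfSingularities.ResolutionOfSingularities.Theorems

open Literature.AlgebraicGeometry.Resolution
open Literature.AlgebraicGeometry.Resolution.Hauser2010
/-! ## The Fin form of the termination theorem, and the closer by name -/

namespace CampaignW46.MohWindowShadeTerminalCentresExit

open CentreBlowup PointBlowup MvPolynomial

variable (p : ℕ) [Fact p.Prime] {K : Type*} [Field K] [DecidableEq K] [CharP K p] {σ : Type*} [Fintype σ]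
  [DecidableEq σ]

/-- **[OURS · L1 W4.6] TERMINATION of the terminal case under minimal permissible coordinate centres, FINITE-WALK FORM**:
res-L1-s46-pv-6's `length_le_of_minimalCentres` with the two centre hypotheses (`Σ_{S n} r_n ≥ p`, minimality) asked
only for `n < N` — the proof is the same induction on `n ≤ N` (cleaned, `y^r ∣ F`, terminal, `p ≤ |r n|`,
`|r n| + n ≤ |r₀|`), which invokes the centre hypotheses only at the index `n < N` of the step being taken. Closes the
repaired OURS statement `CampaignW46MohWindowShadeTerminalCentreTerminatesFin` (OURS-desk #73 repair). [folklore] -/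
theorem length_le_of_minimalCentresFin (s : ℕ → CState σ K) (S : ℕ → Finset σ) (j : ℕ → σ)
    (b : ℕ → σ → K) (hj : ∀ n, j n ∈ S n) (hb : ∀ n, b n (j n) = 0)
    (hbN : ∀ n i, i ∉ S n → b n i = 0)
    (hstep : ∀ n, s (n + 1) = step p (S n) (j n) (b n) (s n))
    (hclean : deletePthPowers p (s 0).F = (s 0).F) (hr : ∀ d ∈ (s 0).F.support, (s 0).r ≤ d)
    (hord : ordZero (s 0).F = ((s 0).r.degree : ℕ)) (hlo : p < (s 0).r.degree)
    (hhi : (s 0).r.degree < 2 * p) {N : ℕ}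
    (hS : ∀ n, n < N → p ≤ degIn (S n) (s n).r)
    (hmin : ∀ n, n < N → ∀ i ∈ S n, degIn ((S n).erase i) (s n).r < p)
    (heq : ∀ n, n < N → IsEquimultiplePoint p (S n) (j n) (b n) (s n)) :
    N + p ≤ (s 0).r.degree := by
  classical
  have hinv : ∀ n, n ≤ N →
      deletePthPowers p (s n).F = (s n).F ∧ (∀ d ∈ (s n).F.support, (s n).r ≤ d) ∧
      ordZero (s n).F = ((s n).r.degree : ℕ) ∧ p ≤ (s n).r.degree ∧
      (s n).r.degree + n ≤ (s 0).r.degree := by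
    intro n
    induction n with
    | zero => intro _; exact ⟨hclean, hr, hord, hlo.le, le_rfl⟩
    | succ n ih =>
      intro hn
      obtain ⟨h1, h2, h3, h5, h6⟩ := ih (by omega)
      have hnN : n < N := by omega
      have heqn := heq n hnN
      have hSn := hS n hnN
      have hminn := hmin n hnN (j n) (hj n)
      have hlt : p < (s n).r.degree := by
        rcases h5.lt_or_eq with h | h
        · exact h
        · exact absurd heqn (not_isEquimultiplePoint_of_degree_eq p (hj n) (b n) (hb n) (hbN n) (s n)
            h1 h2 h3 h.symm hSn hminn)
      have hhi' : (s n).r.degree < 2 * p := by omega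
      rw [hstep n]
      refine ⟨deletePthPowers_step p (S n) (j n) (b n) (s n),
        newMult_le_of_mem_support_step p (S n) (j n) (b n) (hb n) (s n) h3 h2
          (MohWindowShadeTerminalCentres.perm_of_terminal (S n) (s n) h2),
        MohWindowShadeTerminalCentres.ordZero_step_eq p (hj n) (b n) (hb n) (hbN n) (s n) h2 h3 hlt hhi' hSn,
        (MohWindowShadeTerminalCentres.isEquimultiplePoint_iff p (hj n) (b n) (hb n) (hbN n) (s n) h2 h3
          hlt hhi' hSn).mp heqn,
        ?_⟩
      have := MohWindowShadeTerminalCentres.degree_step_r_lt p (S n) (j n) (b n) (hb n) (s n) h2 h3 hSn hminn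
      omega
  obtain ⟨-, -, -, h5, h6⟩ := hinv N le_rfl
  omega

end CampaignW46.MohWindowShadeTerminalCentresExit

section Closer

variable (p : ℕ) [Fact p.Prime] (K : Type*) [Field K] [DecidableEq K] [CharP K p] (σ : Type*) [Fintype σ]
  [DecidableEq σ]

/-- **[OURS · L1 W4.6] `CampaignW46MohWindowShadeTerminalCentreTerminatesFin` holds** for every prime `p`, field `K`
of characteristic `p` and finite `σ` (closer BY NAME of the OURS-desk #73 repair; proof =
`CampaignW46.MohWindowShadeTerminalCentresExit.length_le_of_minimalCentresFin`). NOT a statement of the manuscript.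
[folklore] -/
theorem campaignW46MohWindowShadeTerminalCentreTerminatesFin_holds :
    CampaignW46MohWindowShadeTerminalCentreTerminatesFin p K σ :=
  fun s S j b hj hb hbN hstep hclean hr hord hlo hhi _N hS hmin heq =>
    CampaignW46.MohWindowShadeTerminalCentresExit.length_le_of_minimalCentresFin p s S j b hj hb hbN hstep hclean
      hr hord hlo hhi hS hmin heq

end Closer

end Summit.ResolutionOfSingularities.ResolutionOfSingularities.Theorems

end
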